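import Summits.CriticalPhenomena.PercolationContinuityZ3.Theorems.PercNearOneGluingNoHeavyLowerTailThreePartitionAD

/-!
# `NoHeavyLowerTail` (crux stmt-CriticalPhenomena-4575), route P3 (Ahlswede–Daykin): the TWISTED three-partition functional
# (general three-copy profiles) and its merge chain

Support file (cell `prim-l12`, seat P3; `--supports stmt-CriticalPhenomena-4575`), companion of `…ThreePartitionAD`.

CORRECTION / COMPLETION of the companion's header.  The reduction of an ARBITRARY three-copy profile of an up-set triple of a
finite cube to ordered 3-partitions needs a twist: if `τ` is the set of active coordinates open in exactly TWO copies (the other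
active coordinates being open in exactly one), then copy `a` equals `S_a ∆ τ`, where `S_a` is the set of active coordinates whose
ODD copy is `a`; `(S₁,S₂,S₃)` is an ordered 3-partition but `(S₁ ∆ τ, S₂ ∆ τ, S₃ ∆ τ)` is not, and `S ↦ S ∆ τ` does not preserve
up-sets.  Hence the statement EQUIVALENT to the cell's COMB-C3 ("every three-copy fibre sum of the Richards–Sahi kernel is
`≥ 0`", prim-sahi P1 `checkCube`, ttrl2 `rcomb`) is `ThreePartitionPositivityTwisted` below (all `τ`), while the companion's
`ThreePartitionPositivity` is its slice `τ = ∅` (`threePartNT_empty`, `threePartitionPositivity_of_twisted`); the phrase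
"equivalent to fibre (comb) positivity" in the companion's docstrings is to be read with this proviso.  Census of the twisted
family (seat folder `lab/fib3t.c`, exact): all `(triple, τ)` for `m ≤ 4`: `20 / 224 / 12 320 / 12 871 040` pairs, `0` negative,
`245 768` zeros at `m = 4` (`12.87 M` = prim-sahi P1's independent `py/comb.py` count).

The two-function content is unchanged and proved here in full generality: copy `3` is copy `2` reflected on the complement of the
spectator part `S₁`, and copy `2` ranges over the folding fibre `(S₁ᶜ, S₁ ∩ τ)`; so the tree's fibrewise four-EVENTS theorem
(`FoldingFibre.fibreCount_le_of_fourEvents`, Aharoni–Keich Prop. 4.4 / Christofides Thm 2.2) gives the merge chain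
`teeT ≤ deeT ≤ topT` for every `τ` (`teeT_le_deeT`, `deeT_le_topT`), and `3·N_τ = 2·Σᵢ(topT − deeTᵢ) − Σᵢ(deeTᵢ − teeT)`
(`threePartNT_eq_convexity`).  The NO-GO certificates recorded in the companion's header are statements about incidence TYPES
(which copy lies in which event) and use only rows valid on every folding fibre, so they apply verbatim to every `τ`:
no event-measurable instance of the Ahlswede–Daykin / Rinott–Saks / Aharoni–Keich family certifies `N_τ ≥ 0`.
-/

noncomputable section

open Finset
open scoped symmDiff Classical

namespace Summit.CriticalPhenomena.PercolationContinuityZ3.Theorems.ThreePartition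

open Literature.Probability.Percolation

variable {ι : Type*} [Fintype ι]

/-! ## The twisted counts -/

/-- Twisted 3-partition count: parts `(S₁,S₂,S₃)`, copies `S_a ∆ τ`. [this work] -/
def triT (τ : Set ι) (p : Set ι → Set ι → Set ι → Prop) : ℕ :=
  tri fun S₁ S₂ S₃ => p (S₁ ∆ τ) (S₂ ∆ τ) (S₃ ∆ τ)

/-- Twisted `top`: `#{(S₁,S₂,S₃) : S₃ ∆ τ ∈ 𝒞}`. [this work] -/
def topT (τ : Set ι) (𝒞 : Set (Set ι)) : ℕ := triT τ fun _ _ x₃ => x₃ ∈ 𝒞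

/-- Twisted `dee`: `#{(S₁,S₂,S₃) : S₁ ∆ τ ∈ 𝒜, S₃ ∆ τ ∈ ℬ}`. [this work] -/
def deeT (τ : Set ι) (𝒜 ℬ : Set (Set ι)) : ℕ := triT τ fun x₁ _ x₃ => x₁ ∈ 𝒜 ∧ x₃ ∈ ℬ

/-- Twisted `tee`: `#{(S₁,S₂,S₃) : S₁ ∆ τ ∈ 𝒰, S₂ ∆ τ ∈ 𝒱, S₃ ∆ τ ∈ 𝒲}`. [this work] -/
def teeT (τ : Set ι) (𝒰 𝒱 𝒲 : Set (Set ι)) : ℕ := triT τ fun x₁ x₂ x₃ => x₁ ∈ 𝒰 ∧ x₂ ∈ 𝒱 ∧ x₃ ∈ 𝒲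

/-- The twisted three-partition functional (`= ⅙ ×` the fibre sum of the Richards–Sahi kernel on the profile "coordinates of
`τ` open in two copies, the others in one"). [this work] -/
def threePartNT (τ : Set ι) (𝒰 𝒱 𝒲 : Set (Set ι)) : ℤ :=
  2 * (topT τ (𝒰 ∩ 𝒱 ∩ 𝒲) : ℤ) + teeT τ 𝒰 𝒱 𝒲
    - (deeT τ 𝒰 (𝒱 ∩ 𝒲) + deeT τ 𝒱 (𝒰 ∩ 𝒲) + deeT τ 𝒲 (𝒰 ∩ 𝒱) : ℕ)

/-- **Twisted three-partition positivity** (this work; OPEN; the form equivalent to fibre positivity of `E₃` on all profiles):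
for every finite `ι`, every `τ ⊆ ι` and all up-sets `𝒰, 𝒱, 𝒲`, `threePartNT τ 𝒰 𝒱 𝒲 ≥ 0`.  Census: exhaustive `m ≤ 4`
(`12 871 040` pairs `(triple, τ)`), `0` negative; = prim-sahi P1 `checkCube 4` / ttrl2 `rcomb k ≤ 5`.  An obligation, never a fact.
[status: open] -/
@[conjecture] def ThreePartitionPositivityTwisted : Prop :=
  ∀ (ι : Type) [Fintype ι] (τ : Set ι) (𝒰 𝒱 𝒲 : Set (Set ι)),
    IsUpperSet 𝒰 → IsUpperSet 𝒱 → IsUpperSet 𝒲 → 0 ≤ threePartNT τ 𝒰 𝒱 𝒲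

omit [Fintype ι] in
/-- `triT ∅ = tri`. [this work] -/
theorem triT_empty (p : Set ι → Set ι → Set ι → Prop) [Fintype ι] : triT (∅ : Set ι) p = tri p := by
  have h : ∀ S : Set ι, S ∆ (∅ : Set ι) = S := fun S => symmDiff_bot S
  unfold triT
  simp only [h]

/-- `threePartNT ∅ = threePartN`: the untwisted slice. [this work] -/
theorem threePartNT_empty (𝒰 𝒱 𝒲 : Set (Set ι)) : threePartNT (∅ : Set ι) 𝒰 𝒱 𝒲 = threePartN 𝒰 𝒱 𝒲 := by
  unfold threePartNT threePartN topT deeT teeT top dee tee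
  simp only [triT_empty]

/-- The twisted conjecture contains the untwisted one. [this work] -/
theorem threePartitionPositivity_of_twisted (h : ThreePartitionPositivityTwisted) : ThreePartitionPositivity := by
  intro ι _ 𝒰 𝒱 𝒲 h𝒰 h𝒱 h𝒲
  rw [← threePartNT_empty]
  exact h ι ∅ 𝒰 𝒱 𝒲 h𝒰 h𝒱 h𝒲

omit [Fintype ι] in
/-- Pointwise twist identity: if `S ∩ T = ∅` then `(S ∪ T)ᶜ ∆ τ = (T ∆ τ) ∆ Sᶜ`. [folklore] -/
theorem compl_union_symmDiff_eq {S T τ : Set ι} (h : Disjoint S T) : (S ∪ T)ᶜ ∆ τ = (T ∆ τ) ∆ Sᶜ := by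
  ext x
  have hx : x ∈ S → x ∉ T := fun h1 h2 => Set.disjoint_left.1 h h1 h2
  simp only [Set.mem_symmDiff, Set.mem_compl_iff, Set.mem_union, not_or]
  tauto

omit [Fintype ι] in
/-- If `S ∩ T = ∅` then `(T ∆ τ) \ Sᶜ = S ∩ τ` (copy `T ∆ τ` lies in the folding fibre `(Sᶜ, S ∩ τ)`). [folklore] -/
theorem symmDiff_diff_compl_eq {S T τ : Set ι} (h : Disjoint S T) : (T ∆ τ) \ Sᶜ = S ∩ τ := by
  ext x
  have hx : x ∈ S → x ∉ T := fun h1 h2 => Set.disjoint_left.1 h h1 h2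
  simp only [Set.mem_sdiff, Set.mem_symmDiff, Set.mem_compl_iff, not_not, Set.mem_inter_iff]
  tauto

omit [Fintype ι] in
/-- Conversely, if `a \ Sᶜ = S ∩ τ` then `S` and `a ∆ τ` are disjoint. [folklore] -/
theorem disjoint_symmDiff_of_diff_compl_eq {S a τ : Set ι} (h : a \ Sᶜ = S ∩ τ) : Disjoint S (a ∆ τ) := by
  rw [Set.disjoint_left]
  intro x hxS hxa
  have key : x ∈ a \ Sᶜ ↔ x ∈ S ∩ τ := by rw [h]
  simp only [Set.mem_sdiff, Set.mem_compl_iff, not_not, Set.mem_inter_iff] at key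
  rw [Set.mem_symmDiff] at hxa
  tauto

/-- Core reindexing: for a fixed spectator `S`, the parts `T` disjoint from `S` correspond (via `T ↦ T ∆ τ`) to the folding
fibre `{a : a \ Sᶜ = S ∩ τ}`, the third copy being the reflection `a ∆ Sᶜ`. [this work] -/
theorem card_twist_eq (S τ : Set ι) (Q : Set ι → Set ι → Prop) :
    (Finset.univ.filter fun T : Set ι => Disjoint S T ∧ Q (T ∆ τ) ((S ∪ T)ᶜ ∆ τ)).card =
      (Finset.univ.filter fun a : Set ι => a \ Sᶜ = S ∩ τ ∧ Q a (a ∆ Sᶜ)).card := by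
  refine card_bij (fun T _ => T ∆ τ) (fun T hT => ?_) (fun T _ T' _ hTT => ?_) (fun a ha => ?_)
  · simp only [mem_filter, mem_univ, true_and] at hT ⊢
    obtain ⟨hd, hQ⟩ := hT
    refine ⟨symmDiff_diff_compl_eq hd, ?_⟩
    rw [← compl_union_symmDiff_eq hd]; exact hQ
  · exact symmDiff_left_injective τ hTT
  · simp only [mem_filter, mem_univ, true_and] at ha
    obtain ⟨hfib, hQ⟩ := ha
    have hd : Disjoint S (a ∆ τ) := disjoint_symmDiff_of_diff_compl_eq hfib
    refine ⟨a ∆ τ, ?_, symmDiff_symmDiff_cancel_right τ a⟩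
    simp only [mem_filter, mem_univ, true_and]
    refine ⟨hd, ?_⟩
    rw [symmDiff_symmDiff_cancel_right, compl_union_symmDiff_eq hd, symmDiff_symmDiff_cancel_right]
    exact hQ

/-- Spectator = FIRST part, twisted: `triT τ p = Σ_S #{a : a \ Sᶜ = S ∩ τ ∧ p (S ∆ τ) a (a ∆ Sᶜ)}`. [this work] -/
theorem triT_eq_sum_fst (τ : Set ι) (p : Set ι → Set ι → Set ι → Prop) :
    triT τ p = ∑ S : Set ι, (Finset.univ.filter fun a : Set ι => a \ Sᶜ = S ∩ τ ∧ p (S ∆ τ) a (a ∆ Sᶜ)).card := by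
  unfold triT tri
  rw [card_filter, ← univ_product_univ, sum_product]
  refine sum_congr rfl fun S _ => ?_
  rw [← card_twist_eq S τ (fun a b => p (S ∆ τ) a b), card_filter]

/-- Spectator = SECOND part, twisted: `triT τ p = Σ_S #{b : b \ Sᶜ = S ∩ τ ∧ p b (S ∆ τ) (b ∆ Sᶜ)}`. [this work] -/
theorem triT_eq_sum_snd (τ : Set ι) (p : Set ι → Set ι → Set ι → Prop) :
    triT τ p = ∑ S : Set ι, (Finset.univ.filter fun b : Set ι => b \ Sᶜ = S ∩ τ ∧ p b (S ∆ τ) (b ∆ Sᶜ)).card := by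
  unfold triT tri
  rw [card_filter, ← univ_product_univ, sum_product, sum_comm]
  refine sum_congr rfl fun S _ => ?_
  rw [← card_twist_eq S τ (fun b c => p b (S ∆ τ) c), card_filter]
  refine sum_congr rfl fun T _ => ?_
  simp only [disjoint_comm, Set.union_comm]

/-- **Twisted merge chain, step 1: `teeT ≤ deeT`** (four functions on the folding fibre `(S₁ᶜ, S₁ ∩ τ)`). [this work] -/
theorem teeT_le_deeT (τ : Set ι) (𝒰 : Set (Set ι)) {𝒱 𝒲 : Set (Set ι)} (h𝒱 : IsUpperSet 𝒱) (h𝒲 : IsUpperSet 𝒲) :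
    teeT τ 𝒰 𝒱 𝒲 ≤ deeT τ 𝒰 (𝒱 ∩ 𝒲) := by
  unfold teeT deeT
  rw [triT_eq_sum_fst, triT_eq_sum_fst]
  refine sum_le_sum fun S _ => ?_
  by_cases hS : S ∆ τ ∈ 𝒰
  · have hyp : ∀ a ∈ 𝒱, ∀ b ∈ 𝒲, a ∩ b ∈ (Set.univ : Set (Set ι)) ∧ a ∪ b ∈ 𝒱 ∩ 𝒲 :=
      fun a ha b hb => ⟨Set.mem_univ _, h𝒱 Set.subset_union_left ha, h𝒲 Set.subset_union_right hb⟩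
    have hf := FoldingFibre.fibreCount_le_of_fourEvents hyp Sᶜ (S ∩ τ)
    refine le_trans (le_trans (card_le_card fun a ha => ?_) hf) (card_le_card fun a ha => ?_)
    · simp only [mem_filter, mem_univ, true_and] at ha ⊢
      exact ⟨ha.1, ha.2.2.1, ha.2.2.2⟩
    · simp only [mem_filter, mem_univ, Set.mem_univ, true_and] at ha ⊢
      exact ⟨ha.1, hS, ha.2⟩
  · refine card_le_card fun a ha => ?_
    simp only [mem_filter, mem_univ, true_and] at ha
    exact absurd ha.2.1 hS

/-- **Twisted merge chain, step 2: `deeT ≤ topT`** (four functions on the folding fibre `(S₂ᶜ, S₂ ∩ τ)`). [this work] -/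
theorem deeT_le_topT (τ : Set ι) {𝒜 ℬ : Set (Set ι)} (h𝒜 : IsUpperSet 𝒜) (hℬ : IsUpperSet ℬ) :
    deeT τ 𝒜 ℬ ≤ topT τ (𝒜 ∩ ℬ) := by
  unfold deeT topT
  rw [triT_eq_sum_snd, triT_eq_sum_snd]
  refine sum_le_sum fun S _ => ?_
  have hyp : ∀ s ∈ 𝒜, ∀ b ∈ ℬ, s ∩ b ∈ (Set.univ : Set (Set ι)) ∧ s ∪ b ∈ 𝒜 ∩ ℬ :=
    fun s hs b hb => ⟨Set.mem_univ _, h𝒜 Set.subset_union_left hs, hℬ Set.subset_union_right hb⟩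
  have hf := FoldingFibre.fibreCount_le_of_fourEvents hyp Sᶜ (S ∩ τ)
  refine le_trans (le_trans (card_le_card fun b hb => ?_) hf) (card_le_card fun b hb => ?_)
  · simp only [mem_filter, mem_univ, true_and] at hb ⊢
    exact hb
  · simp only [mem_filter, mem_univ, Set.mem_univ, true_and] at hb ⊢
    exact hb

/-- The twisted functional as convexity along the merge chain: `3·N_τ = 2·Σᵢ(topT − deeTᵢ) − Σᵢ(deeTᵢ − teeT)`. [this work] -/
theorem threePartNT_eq_convexity (τ : Set ι) (𝒰 𝒱 𝒲 : Set (Set ι)) :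
    3 * threePartNT τ 𝒰 𝒱 𝒲 =
      2 * ((topT τ (𝒰 ∩ 𝒱 ∩ 𝒲) - deeT τ 𝒰 (𝒱 ∩ 𝒲) : ℤ) + (topT τ (𝒰 ∩ 𝒱 ∩ 𝒲) - deeT τ 𝒱 (𝒰 ∩ 𝒲) : ℤ)
          + (topT τ (𝒰 ∩ 𝒱 ∩ 𝒲) - deeT τ 𝒲 (𝒰 ∩ 𝒱) : ℤ))
      - ((deeT τ 𝒰 (𝒱 ∩ 𝒲) - teeT τ 𝒰 𝒱 𝒲 : ℤ) + (deeT τ 𝒱 (𝒰 ∩ 𝒲) - teeT τ 𝒰 𝒱 𝒲 : ℤ)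
          + (deeT τ 𝒲 (𝒰 ∩ 𝒱) - teeT τ 𝒰 𝒱 𝒲 : ℤ)) := by
  unfold threePartNT
  push_cast
  ring


end Summit.CriticalPhenomena.PercolationContinuityZ3.Theorems.ThreePartition
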